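import Literature.Claims.NS.ClayVariants
import Literature.Analysis.FunctionSpaces.TorusCalculus
import HarnessLib

/-!
# Claim skeleton: Moschandreou (2024), «From Hölder Continuous Solutions of 3D Incompressible
# Navier-Stokes Equations to No-Finite Time Blowup on [0,∞]» (Adv. Pure Math. 14(9) 695–743)

Cell `ns-claims` (D-0090 NS-CLAIMS SWEEP), claim C05c, typist `ns-claims-typist-5`.
CLAIM UNDER ADJUDICATION (SCIRP journal item; no erratum known) — NOTHING in this file asserts a
step: every `Step_k` is a `Prop` (the paper's k-th load-bearing assertion, typed concretely so that
`¬ Step_k` or its vacuity can be a kernel theorem filed summit-side as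
`Theorems/SoloRefuteMoschandreou2024.lean`); the only `theorem`s are logic (`claim_of_steps`,
`step_8_iff_claimedTheorem`, `not_step_6_of_step_5`), one discharged routine step
(`step_7_holds`) and unfolding/API lemmas.

Version of record: T. E. Moschandreou, *Advances in Pure Mathematics* **14**(9) (2024) 695–743,
doi:10.4236/apm.2024.149038 [Moschandreou2024b] (NB: the bib key `Moschandreou2024` is the same
author's OTHER 2024 paper, Applied Math. Sci. 18(3)). SOURCES on the hub (ns-claims-lit-1,
`pub/ns-claims/sources/Moschandreou2024/APM14-9-2024-publisher-PDF/`): the publisher PDF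
`apm2024149_15302471.pdf` (sha16 3ce237c3678a7ef6, 49 pp.; PRINTED PAGE = PDF PAGE + 694,
`PAGEMAP.md`), the SCIRP JATS XML with MathML (`scirp-135923-JATS-fulltext.xml`, 956 formulas,
linearised in `fulltext-from-JATS-MathML.md` — the displays are read THERE), and the archived HTML
text (`pub/ns-claims/census/texts/Moschandreou-APM14-9-2024-…-webarchive20251117.txt`, sha16
95ecba209c477eb8, census). LOCATORS below are «§n» + equation / theorem / figure numbers + printed
page «p.N», and `L<n>` = sentence line of the typist's reflowed HTML text
`claims/Moschandreou2024/apm149038-reflowed.txt` (sha16 6c8fedb9648493a0; kept for grep). The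
displays (6)–(13), (26)–(29), (37)–(40), (42), (44), (A2.2) are legible in the MathML text; they
are NOT typed for the reasons under «Not typed» below (rev 2: print pages added; rev 1 = p478433).
Lineage: C05 `Moschandreou2021` (arXiv 2011.07419 v4, a different mechanism — fixed horizontal
ansatz; ADJUDICATED wrong problem) and C05b `Moschandreou2022` (opposite direction).

## Claimed statement (as printed)

§1 Introduction, p.697, L59–63: «In the present paper, proposition B (hence A) is proposed to be true in
the Millennium problem for the PNS Cauchy initial value system of equations. The blowup points for
Hölder functions in higher derivatives can be shifted procedurally to arbitrarily large time t.
However, at infinity it [is still] to show that there is no blowup there. Here the case of the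
asymptotic limit as δ → 0 is proposed to exist [3]. So the claim is that there is no finite time
blowup on [0, ∞].» §3, p.701, L124: «a sequence in L^q(ℝ³) for each q ∈ [2,3) is shown to converge to a
C^∞ solution as required in the proof of the Millennium prize problem proposition B) for the
Navier Stokes equations.» §13, p.730, L414: «superimpose a more general periodic solution about the
constant ζ solution and fulfill the requirements for the millennium problem.» Setting §4 p.702, L127–128:
«the incompressible 3D Navier-Stokes equations defined on the 3-Torus T³ = ℝ³/ℤ³. The PNS system
is ∂u/∂t − Δu + u·∇u = −∇p + f, div u = 0, u|_{t=0} = u₀ (2)»; [10] = Fefferman's Clay text.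
Abstract, p.695, L30 (MODEL level): «It is proven that the limit of these singular problems shifts the
finite time blowup time t_i* for first and higher derivatives to t = ∞ thereby indicating that
there is no finite time blowup.» Hedges: «is proposed» (L59, L479, §17 L480–484).
Typed: `ClaimedTheorem := ClayVariants.clayPeriodic.Regularity` — Clay (B) as printed («proposition
B of [10]»), the C05 pattern; the abstract's model-level sentence is Steps 5–6 below.

## Clay delta (reference `ClayVariants.lean`)

Nearest: (B); `clayB_of_claimed` is `id`. The delta is not in the claimed sentence but in WHAT THE
ARGUMENT TREATS — recorded, not kernel objects (the displays are illegible in the text of record):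
(Δ3 FORCE) the PNS system (2) is solved with the paper's SINGULAR forcing, §4 p.705, L141–151:
«F*_{T1} = F*_{T2} = F*_{sz} = ℘((W(F(y,s)) + 1)⁻¹, 3m², m³)⁻³ … When W(F) = −1 the forcing is
singular … We set F = −1/e + r. At the center of ball forcing is singular as r → 0», while (B) has
`f ≡ 0` — the paper's passage to zero force is Step 7 («the forcing is zero … when one
differentiates the constant velocity wrt t and using Newton's second law», p.727, L398); (Δ2 EQUATIONS)
what is solved is the REDUCED equation (26)/(29)/(42)–(43) for one component `v₃` «valid in an
arbitrary ε ball of T³» (p.706) on the subspaces `J₁, J₂, J₃` (21)–(25), §8–§9, after the term `G_δ3` is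
dropped on the strength of Step 1; (Δ4 DATA) «data was assumed to be given by ζ alone and
arbitrarily large» (p.727, L400; p.707, L186–187 «y₃ = 1/ζ(s) + C»); (Δ5/Δ6) the objects reaching `t = ∞` are
the explicit Lambert-W iterates of Steps 4–6, locally Hölder-1/3 (p.706 L179, p.715 L271), their «limit» a
constant (p.727, L397). The ONLY printed bridge from this model to arbitrary smooth periodic data is the
superposition sentence p.730 (L414) = Step 8, which is the claimed statement itself up to adding a constant
(`step_8_iff_claimedTheorem`, proved here: ROUTE 5b «circular» kernel face). The author's own
caveats: p.697 L61 (no blow-up at infinity still to be shown), L62 (the δ → 0 limit «proposed to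
exist [3]»), §17 p.737 L482–483 (a rigorous proof that the scaling limit `v = lim u_λ` is again a solution is
deferred to future work) — verbatim in CARD §2/§7.

## Steps (ordered index, TYPING-HYGIENE 11: dependency order of the printed argument)

* Step 1 = `Step_1` (support variant `Step_1'`) — §6 «Inequalities for Derivatives», the display
  between (18) and (19), p.710, L219–221: «‖∇b‖_∞ ≤ c(γ,m)‖Δᵐb‖₂^{θ₂}‖b‖₂^{θ₁} ≤ c₁‖Δb‖₂ = c₁∫_{T³}|Δb|²dx
  … [Rumer–Fet ball-average Laplacian, Jensen] … ∫_{T³}|Δb|² dx = … = (15/2) lim_{ε→0} (4π/3)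
  dψ(x) ε³ ∭ [[[ψ(x)]_{x=−L}^{x=L}]_{y=−L}^{y=L}]_{z=−L}^{z=L} dx′ = 0 … due to periodicity the
  integral on T³ becomes zero», for `b` = the (scaled) velocity field (§2 L94), «in the class
  W^{2,2m}(T³) of functions f under consideration» (p.709, L215); CONSUMED at (19)–(20) «C = 0
  there» (p.710, L222) ⇒ «r × ∇D⁻¹[G − G₃] = 0 as the volume tends to that of ℝ³» (p.708, L207), i.e. the removal of the
  tensor-product/pressure-surface term `G_δ3` (9) that makes the one-component reduction of §8–§9
  possible (p.710, L226 «the tensor product term in Equation (8) which is negligible»). Typed on the unit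
  flat torus for every smooth periodic vector field (`Step_1`), and restricted to smooth
  divergence-free mean-zero fields (`Step_1'`, p.709 L213 «applies to mean zero solutions»). Typist's
  private flag: known-false pattern (a Laplacian eigenfield, e.g. `FluidPDE.Torus.abcFlow`, has
  `∫‖Δb‖² = 16π⁴(A²+B²+C²)`).
* Step 2 = `Step_2` (variant `Step_2sum`) — §9, pp.715–716, L277–281: «an integration about all x ∈ T³ is
  performed to recapture the general spatial and time components of Equation (29) … T³ = ∪_a
  D_c(a,r) … partitioned in such disjoint cubes … (1/Vol D_c)∫_{∪D_c} ∂u_z/∂t dv = (1/Vol D_c)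
  ∫_{∪D_c} L(u_z) dv … in the limit as the radius of the ball approaches zero … Σ_a(∂u_z(a,t)/∂t −
  L u_z(a,t)) = 0. Here if the argument of the summation is not zero then due to uncountable
  summations a contradiction follows, thus ∂u_z(a,t)/∂t − L u_z(a,t) = 0 for any a, t» («u_z is
  taken to be continuous»). For the `r`-partition the normalised sum of cell integrals of the
  continuous function `g = (∂_t u_z − L u_z)(·,t)` is `(Vol D_c)⁻¹ ∫_{T³} g`, so the printed
  hypothesis is `∫_{T³} g = 0` and the conclusion `g ≡ 0` (`Step_2`); the literal «uncountable
  sum» reading is `Step_2sum` (`HasSum g 0 ⇒ g ≡ 0`). Flag: known-false pattern (both readings).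
* Step 3 = `Step_3` — §12 «Results», p.718, L299: «The singularity of the solution in terms of the LambertW
  function occurs at the point (−1/e, −1) where the W function has a first derivative
  singularity»; §14 p.731 L425 («a first derivative blowup … at blowup point t = T*»); §1 p.697 L64 («Taking
  δ ≠ 0 establishes non smooth or singular solutions at a finite time»). Typed for the principal
  real branch, characterised by `IsPrincipalLambert` («e^{−W(ξ)} = W(ξ)/ξ», p.695 L25, p.702 L137). Flag: true —
  PROVED in-file, `step_3_holds` (revision: `W` is the inverse of the strictly increasing `w ↦ w e^w` on
  `[−1,∞)`; continuity by monotonicity + interval image, non-differentiability by the chain rule at `w = −1`).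
* Step 4 = `Step_4` — COMPOSITION INVARIANCE, §13 p.727 L396 «Any finite number of compositions will
  result in a solution as well to Equations (37)-(40)»; §16 p.737 L478 «due to the additive property of
  the argument of the exponential of the Lambert function W … any finite composition of solutions
  v_i will also be solutions of PNS simply by shifting the data term ζ and constants»; App. 2 (A2.2)
  p.743 «V₃ = W^{(N)}[v₃ + 2^N f] … solves Equation (29) for any N ∈ ℝ⁺ by mathematical induction».
  Typed at the grain of the paper's reduced equation §14 (43) p.730 «((δ−1)/μ)(∂v₃/∂s)² = κ²» (whose
  solutions are (44) p.731 «v₃ = −√((δ−1)μ) s κ/(δ−1) + F₁(y₁,y₂,y₃)»): composing a solution of (43) with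
  `W` on a time interval where it stays in `W`'s domain gives a solution of (43). The (29)/(37)–(40)
  forms are not typed (formula objects (37)–(40), and the PDE (29) with its `(10/ε² − 1)` factors «of
  order 1 in the limit», have no fixed meaning to type against); the (A2.2) form with an unconstrained
  `f` has no checkable content (any function is `W^{(N)}[v₃ + 2^N f]` for some `f`). Flag: suspicious (`(W∘v)′ =
  W′(v)v′` and `W′ = ±1` only at `0`).
* Step 5 = `Step_5` — SHIFT OF THE BLOW-UP TIMES, §13 p.727 L395 «compositions of n W functions results in
  a shift towards t → +∞» with the model iterates of Figures 17–22 (pp.728–729, L402–412) «u = Re(W(−e^{1−t}))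
  + 1», «Re(W(W(−e^{1−t}))) + 1», …, 19-fold; §16 p.737 L474–475 «will send the finite time singularity
  to infinity … applying W(W(W⋯W(v_i))) n-times keeps moving the blowup points further and further
  to the right on the positive t axis»; App. 2 Fig. A1 p.742 «sending singular points in first
  derivatives to infinity». Typed over the real branch: the `N`-fold iterate at time `t` is
  real-defined iff every inner argument stays `≥ −1/e` (`IterDefined`), its blow-up time is the left
  end of that set (where the outermost `W` sits at its branch point (−1/e,−1), Step 3); printed
  content = monotonicity in `t` and «for every T the N-th blow-up time exceeds T for N large».
  Flag: true on the model (`a₀ = −1/e`, `a_{k+1} = a_k e^{a_k} ↑ 0`) — PROVED in-file, `step_5_holds`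
  (revision: `W` increasing on its domain; on `[−1/e,0)` the iteration `x ↦ W x` decreases with a uniform gap).
* Step 6 = `Step_6` (variant `Step_6lim`) — THE LIMIT, §13 p.727 L397 «In the limit, the velocity
  approaches a constant for all t» (Fig. 23 p.730 «Infinite limit of n compositions of solution
  approaches a constant»); §16 p.737 L477 «Hence no finite time blowup can occur in the limit as n → ∞
  for the fixed point», L479 «This is true for any n thus in the limit it is proposed that no
  finite-time blowup at infinity occurs and also no finite time singularites on [0,∞) can exist»;
  §17 p.737 L481. Typed over the real branch at model grain: for every `t ≥ 2` all iterates stay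
  real-defined and `u_N(t) → 1` (`W`'s fixed point is `0`). The figures plot `Re` of a complex
  branch whose branch choices along the iteration are not specified in print — that reading is NOT
  typed (no complex Lambert function in Mathlib; nothing to type it against). Flag: on the reals
  Step 5 (iii) and Step 6 are jointly inconsistent (`not_step_6_of_step_5`). `Step_6lim` types the
  inference «true for any n thus in the limit» as a schema (pointwise limit of functions each C¹
  below its singular time `s_n → ∞` is C¹ on [0,∞)) — known-false pattern, and flagged by the author
  himself as still to be proved (§17 p.737 L483, CARD §7).
* Step 7 = `Step_7` — §13 p.727 L398–399 (+ §2 p.699 L97): «proposition B … involves proving that the forcing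
  is zero which it will be when one differentiates the constant velocity wrt to t and using
  Newton's second law. Of course the constant solution is periodic for all x and t.» Typed:
  constant velocity fields are Clay-(B)-sense global smooth periodic solutions with `f ≡ 0`.
  TRUE — `step_7_holds`.
* Step 8 = `Step_8` — THE CLAY PASSAGE, §13 pp.727/730 L400–417: «One can … superimpose a more general
  periodic solution about the constant ζ solution and fulfill the requirements for the millennium
  problem. Note that in Equation (29) solutions are also of the form u_z = U₃ + Ψ₃(x,y), u_y = U₂ +
  Ψ₂(x,z) and u_x = U₁ + Ψ(y,z). These functions can be taken to be periodic on ℝ × ℝ.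
  Superimposing is possible since x/√t is a constant in the limit as t → ∞.» (with §1 p.697 L59–63).
  Typed: for every constant `c` and every Clay (B) datum `u₀` the datum `c + u₀` has a Clay-sense
  global smooth periodic solution with `f ≡ 0` — `step_8_iff_claimedTheorem : Step_8 ↔
  ClaimedTheorem` (both directions one line: `c = 0`, resp. `c + u₀` is again a (B) datum). The
  Galilean superposition of a KNOWN solution onto a constant is classical and true; what the
  sentence presupposes is the existence of the «more general periodic solution» — that
  presupposition is Step 8. Flag: restatement of the claim (ROUTE 5b pattern).
Not typed (with reason): §2/§4 (6)–(13) pp.699–705 «the original Navier-Stokes equations are preserved and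
rearranged in the form G(η) = ΣG_δi = 0» (cited to the author's [7] = Moschandreou2023, [8],
[14] = Moschandreou2021b; a 4-part operator identity whose NS-equivalence is asserted, not derived,
in this paper; no typed step uses their form except through Step 1's consumption at (19)–(20)); the
chain (15)–(20) pp.707–708 itself apart from Step 1; §5 p.706–707 L174–183 the `U + εV` split and
«the asymptotic limit as δ → 0 gives V = 0»; §8 pp.712–713 (21)–(25) the sets `J_i` and p.714 L266
«there exists an extension through the Cartesian product which extends the solution to all of T³»;
displays (26)–(29) pp.713–715, (37)–(40) p.720, (42) p.730, (44) p.731, (A2.1)–(A2.2) pp.742–743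
(explicit formula objects / a PDE with `(10/ε² − 1)` factors «of order 1 in the limit» — no fixed
statement to type against); Theorem 1 p.701 (= [2]
Cannone–Karch–Pilarczyk–Wu, mild solutions with singular data — a published theorem, used only as
motivation: p.706 L161–162 «one does not know what the form of the functions are here. So a bottom up
approach must be adhered to»); Theorems 2–6 (Hölder, Riesz–Thorin log-convexity, essential sup,
Hölder, Doering–Foias [23]) — textbook/cited; §1 p.696–697 L52–55 / L62 / §17 p.737 L483 the δ → 0
scaling limit via
Planchon [3] (same inference pattern as `Step_6lim`; author-flagged as future work).

## COMPOSITION — proved as `claim_of_steps`, BUT ONLY THROUGH STEP 8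

`claim_of_steps : Step_1 → … → Step_8 → ClaimedTheorem` is a theorem whose proof term uses `Step_8`
alone (`step_8_iff_claimedTheorem.mp`): in the printed argument Steps 1–7 produce ONE constant
solution of a forced reduced model and Step 8 superimposes onto it «a more general periodic
solution» whose existence is exactly Clay (B). `-- LOGIC: Steps 1–7 ↛ ClaimedTheorem without
Step 8; Step 8 ↔ ClaimedTheorem (kernel: step_8_iff_claimedTheorem).` The refuter/referee decide
whether the locator is the earliest false display on the printed path (Step 1, §6) or the circular
bridge (Step 8, §13) / the STATEMENT delta (Δ3 Δ2 Δ4).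

WHAT THIS IS NOT: not a claim about NS regularity or blow-up; not a claim about any author beyond the
typed locator.
-/

open MeasureTheory Set Filter
open scoped ContDiff Topology Laplacian InnerProductSpace

namespace Literature.Claims.NS.Moschandreou2024

open Literature.Analysis.FluidPDE
open Literature.Analysis.FunctionSpaces

noncomputable section

/-! ## Vocabulary (definitions with bodies; nothing asserted) -/

/-- «W is the LambertW function» (§12 after (38), L318), introduced through its defining identity
«e^{−W(ξ)} = W(ξ)/ξ» (abstract p.695 L25, §4 p.702 L137), i.e. `W(ξ) e^{W(ξ)} = ξ`: the PRINCIPAL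
REAL BRANCH,
characterised on its real domain `[−1/e, ∞)` by `W x ≥ −1` and `W x · e^{W x} = x` (the map
`w ↦ w e^w` is strictly increasing on `[−1, ∞)`, so these two conditions determine `W x` for
`x ≥ −1/e`; values of `W` below `−1/e` are unconstrained and NO typed step reads them). Mathlib has
no Lambert function; the steps quantify over every `W` with this property.
[cite: Moschandreou2024b, §4 after (5) p.702 (L137); §12 after (38) p.720 (L318)] -/
def IsPrincipalLambert (W : ℝ → ℝ) : Prop :=
  ∀ x : ℝ, -Real.exp (-1) ≤ x → -1 ≤ W x ∧ W x * Real.exp (W x) = x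

/-- A principal Lambert function vanishes at `0` (`W(0)·e^{W(0)} = 0`): its fixed point, the
«constant» of §13 p.727 L397 / Fig. 23 p.730 after the shift `+1` of Figures 17–22.
[cite: Moschandreou2024b, §13 p.727 (L397), Fig. 23 p.730 (L414)] -/
theorem IsPrincipalLambert.apply_zero {W : ℝ → ℝ} (hW : IsPrincipalLambert W) : W 0 = 0 := by
  have h0 : -Real.exp (-1) ≤ (0 : ℝ) := by
    have := Real.exp_pos (-1)
    linarith
  rcases mul_eq_zero.mp (hW 0 h0).2 with h | h
  · exact h
  · exact absurd h (Real.exp_ne_zero _)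

/-- The `k`-th inner argument of the model iterates of Figures 17–22: `W^{∘k}(−e^{1−t})`
(«u = Re(W(−e^{1−t})) + 1», «Re(W(W(−e^{1−t}))) + 1», …). [cite: Moschandreou2024b, §13 Figs. 17–22 pp.728–729 (L402–412)] -/
def iterArg (W : ℝ → ℝ) (k : ℕ) (t : ℝ) : ℝ :=
  W^[k] (-Real.exp (1 - t))

/-- The `N`-fold model iterate of Figures 17–22 over the real branch: `u_N(t) = W^{∘N}(−e^{1−t}) + 1`.
[cite: Moschandreou2024b, §13 Figs. 17–22 pp.728–729 (L402–412)] -/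
def modelIterate (W : ℝ → ℝ) (N : ℕ) (t : ℝ) : ℝ :=
  iterArg W N t + 1

/-- The `N`-fold iterate is REAL-DEFINED at time `t`: each of the `N` applications of `W` receives an
argument in the real domain `[−1/e, ∞)` (for `N ≥ 1` this forces `t ≥ 2` already at `k = 0`). The
blow-up time of `u_N` is the left end of `{t | IterDefined W N t}`: there the outermost `W` sits at
its branch point `(−1/e, −1)` «where the W function has a first derivative singularity» (§12
p.718, L299). [cite: Moschandreou2024b, §12 p.718 (L299); §16 p.737 (L474–475)] -/
def IterDefined (W : ℝ → ℝ) (N : ℕ) (t : ℝ) : Prop :=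
  ∀ k : ℕ, k < N → -Real.exp (-1) ≤ iterArg W k t

/-- Unfolding: the zeroth argument is `−e^{1−t}`. [cite: Moschandreou2024b, §13 Fig. 17 p.728 (L402)] -/
theorem iterArg_zero (W : ℝ → ℝ) (t : ℝ) : iterArg W 0 t = -Real.exp (1 - t) := rfl

/-- Unfolding: the next argument is `W` of the previous one. [cite: Moschandreou2024b, §13 Figs. 17–22 pp.728–729 (L402–412)] -/
theorem iterArg_succ (W : ℝ → ℝ) (k : ℕ) (t : ℝ) :
    iterArg W (k + 1) t = W (iterArg W k t) := by
  simp [iterArg, Function.iterate_succ_apply']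

/-! ## The claimed statement -/

/-- **The claim as printed, §1 p.697 L59–63 + §3 p.701 L124 + §13 p.730 L414** («proposition B (hence A) is proposed
to be true in the Millennium problem for the PNS Cauchy initial value system of equations … So the
claim is that there is no finite time blowup on [0, ∞]»; «as required in the proof of the
Millennium prize problem proposition B)»; setting §4 p.702 L127–128 «Navier-Stokes equations defined on
the 3-Torus T³ = ℝ³/ℤ³ … u|_{t=0} = u₀ (2)», [10] = Fefferman): Clay (B) as printed, over the schema
of `ClayVariants.lean` (the C05 pattern). The abstract's model-level sentence (p.695, L30) is Steps
5–6. [cite: Moschandreou2024b, §1 p.697 (L59–63); §3 after (1) p.701 (L124); §13 p.730 (L414)] -/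
def ClaimedTheorem : Prop :=
  ClayVariants.clayPeriodic.Regularity

/-- The claimed sentence IS the printed Clay (B) leaf (schema form). [cite: Moschandreou2024b, §1 p.697 (L59)] -/
theorem clayB_of_claimed (h : ClaimedTheorem) : ClayVariants.clayPeriodic.Regularity :=
  h

/-! ## The steps -/

/-- **Step 1 — §6, the display between (18) and (19), p.710, L219–221, LOAD-BEARING for the reduction**:
«‖∇b‖_∞ ≤ … ≤ c₁‖Δb‖₂ = c₁∫_{T³}|Δb|² dx. In Rumer and Fet's exposition [20] … where the Laplacian
is defined as an integral over an ε ball with centre x, ψ(x) = b(x) and Jensen's inequality is used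
… the following is determined, ∫_{T³}|Δb|² dx = ∫_{T³}(lim_{ε→0} (10/ε³)Δ_ε ψ)² dx = … = 0 … As
ε → 0, x′ → 0 in the ball of radius ε and due to periodicity the integral on T³ becomes zero and
subsequently the integral is zero.» (`b` = the scaled velocity vector of §2, a periodic field on
`T³`; «the class W^{2,2m}(T³) of functions f under consideration», p.709 L215.) Consumed at p.710
L222 «In the sequence of inequalities ending with Inequalities (19)-(20) (C = 0 there)» and p.708
L207 «it can be concluded that r × ∇D⁻¹[G − G₃] = 0». Typed on the unit flat torus `ℝ³/ℤ³` (the paper's `T³`,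
§4 p.702 L127) for every smooth vector field. -- TODO(general period): the paper also writes
`T³ = [−α, α]³`; a period rescaling does not affect the statement. Typist's flag: known-false
pattern. [cite: Moschandreou2024b, §6 display after (18) p.710 (L219–221); consumed at (19)–(20) p.710 (L222) and p.708 (L207)] -/
def Step_1 : Prop :=
  ∀ b : UnitAddTorus (Fin 3) → EuclideanSpace ℝ (Fin 3), Torus.IsSmooth b →
    ∫ x, ‖Torus.laplacian b x‖ ^ 2 = 0

/-- **Step 1′ — the same display restricted to the class the chain (15)–(20) is applied to**, p.709 L213:
«The above sequence of inequalities applies to mean zero solutions and in particular Inequality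
(18) on the space ℋ», with `b` divergence free (continuity equation, §4 (2)). Support variant of
Step 1 (same ordered index). Typist's flag: known-false pattern (`Torus.abcFlow` is smooth,
divergence free and mean zero). [cite: Moschandreou2024b, §6 display after (18) p.710 (L219–221) with §5 p.709 (L213)] -/
def Step_1' : Prop :=
  ∀ b : UnitAddTorus (Fin 3) → EuclideanSpace ℝ (Fin 3), Torus.IsSmooth b →
    Torus.IsDivFree b → Torus.HasZeroMean b →
    ∫ x, ‖Torus.laplacian b x‖ ^ 2 = 0

/-- **Step 2 — §9, pp.715–716, L277–281, «pointwise from integrated»**: «Finally, an integration about all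
x ∈ T³ is performed to recapture the general spatial and time components of Equation (29).
Expressing T³ = ∪_a D_c(a,r) … The 3-Torus is partitioned in such disjoint cubes or cells. Writing
the PDE in Equation (29) as ∂u_z/∂t = L(u_z) … Here u_z is taken to be continuous and it is
written that (1/Vol(D_c(a,r))) ∫_{∪_a D_c(a,r)} ∂u_z/∂t dv = (1/Vol(D_c(a,r))) ∫_{∪_a D_c(a,r)}
L(u_z) dv … = Σ_a ∂/∂t((1/Vol D_c(a,r)) ∫_{D_c(a,r)} u_z dv) and in the limit as the radius of the
ball approaches zero … Σ_a(∂u_z(a,t)/∂t − L u_z(a,t)) = 0. Here if the argument of the summation is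
not zero then due to uncountable summations a contradiction follows, thus ∂u_z(a,t)/∂t − L u_z(a,t)
= 0 for any a, t.» For each `r` the cells partition `T³`, so the normalised sum equals
`(Vol D_c)⁻¹ ∫_{T³} g` with `g = (∂_t u_z − L u_z)(·,t)` continuous: the printed hypothesis is
`∫_{T³} g = 0`, the printed conclusion `g(a) = 0` for every `a`. Typist's flag: known-false pattern.
[cite: Moschandreou2024b, §9 after (29) pp.715–716 (L277–281)] -/
def Step_2 : Prop :=
  ∀ g : UnitAddTorus (Fin 3) → ℝ, Continuous g → ∫ x, g x = 0 → ∀ a, g a = 0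

/-- **Step 2 (literal «uncountable summation» reading)**, p.716, L281: «Σ_a(∂u_z(a,t)/∂t − L u_z(a,t)) = 0.
Here if the argument of the summation is not zero then due to uncountable summations a contradiction
follows, thus … = 0 for any a, t» — a family indexed by the points of `T³` with sum `0` (typed with
`HasSum`, no junk) vanishes identically. Variant of Step 2 (same ordered index). Typist's flag:
known-false pattern (a two-point family `±1`). [cite: Moschandreou2024b, §9 after (29) p.716 (L281)] -/
def Step_2sum : Prop :=
  ∀ g : UnitAddTorus (Fin 3) → ℝ, HasSum g 0 → ∀ a, g a = 0

/-- **Step 3 — §12 «Results», p.718, L299 (+ §14 p.731 L425, §1 p.697 L64)**: «The singularity of the solution in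
terms of the LambertW function occurs at the point (−1/e, −1) where the W function has a first
derivative singularity.» Typed for the principal real branch: `W` is continuous on `[−1/e, ∞)`,
`W(−1/e) = −1`, and `W` is not differentiable (within its domain) at `−1/e`. Typist's flag: true
(classical). [cite: Moschandreou2024b, §12 p.718 (L299); §14 p.731 (L425)] -/
def Step_3 : Prop :=
  ∀ W : ℝ → ℝ, IsPrincipalLambert W →
    ContinuousOn W (Ici (-Real.exp (-1))) ∧ W (-Real.exp (-1)) = -1 ∧
      ¬ DifferentiableWithinAt ℝ W (Ici (-Real.exp (-1))) (-Real.exp (-1))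

/-- **Step 4 — COMPOSITION INVARIANCE, §13 p.727 L396 / §16 p.737 L478 / App. 2 (A2.2) p.743** («Any
finite number of
compositions will result in a solution as well», «any finite composition of solutions v_i will
also be solutions of PNS simply by shifting the data term ζ and constants», «V₃ = W^{(N)}[v₃ + 2^N f]
… solves Equation (29) for any N»), typed at the grain of the reduced equation §14 (43) p.730
«((δ−1)/μ)(∂v₃/∂s)² = κ²» («dividing by viscosity μ ≠ 0, the following equation is introduced»,
L424; its solutions are (44) p.731, affine in `s`): on a time interval on which a solution `v` of (43)
stays inside `W`'s domain, `W ∘ v` again solves (43). The sign condition `0 < (δ−1)/μ` is what (44)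
needs for its square root (§15 p.734 L438 «the scaling is for δ ≥ 1», App. 2 p.742 «as δ → ∞»). Not
typed: the same assertion against (29)/(37)–(40) (formula objects with no fixed equation to type
against) and the (A2.2) form with a free `f` (no checkable content). Typist's flag: suspicious.
[cite: Moschandreou2024b, §13 p.727 (L396); §16 p.737 (L478); §14 (43)–(44) pp.730–731 (L424–425); App. 2 (A2.2) p.743] -/
def Step_4 : Prop :=
  ∀ W : ℝ → ℝ, IsPrincipalLambert W →
    ∀ δ μ κ : ℝ, 0 < (δ - 1) / μ → 0 < κ →
    ∀ a b : ℝ, a < b →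
    ∀ v : ℝ → ℝ, DifferentiableOn ℝ v (Ioo a b) →
      (∀ s ∈ Ioo a b, -Real.exp (-1) < v s) →
      (∀ s ∈ Ioo a b, (δ - 1) / μ * deriv v s ^ 2 = κ ^ 2) →
      ∀ s ∈ Ioo a b, (δ - 1) / μ * deriv (W ∘ v) s ^ 2 = κ ^ 2

/-- **Step 5 — SHIFT OF THE BLOW-UP TIMES, §13 p.727 L395 + Figs. 17–22 pp.728–729, §16 p.737
L474–475, App. 2 Fig. A1 p.742**:
«compositions of n W functions results in a shift towards t → +∞», «applying W(W(W⋯W(v_i)))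
n-times keeps moving the blowup points further and further to the right on the positive t axis»,
for the displayed model iterates `u_N(t) = W^{∘N}(−e^{1−t}) + 1`. Typed over the real branch:
(ii) real-definedness is monotone in `t` (the blow-up time is a threshold), (iii) for every `T`
the `N`-th blow-up time exceeds `T` for some `N` (at time `T` the `N`-fold iterate has left the
real domain). Typist's flag: true on the model (`a₀ = −1/e`, `a_{k+1} = a_k e^{a_k}` increases to
`W`'s fixed point `0`, and the `N`-th blow-up time is `1 − log(−a_{N−1}) → +∞`).
[cite: Moschandreou2024b, §13 p.727 (L395) with Figs. 17–22 pp.728–729 (L402–412); §16 p.737 (L474–475); App. 2 Fig. A1 p.742 (L492)] -/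
def Step_5 : Prop :=
  ∀ W : ℝ → ℝ, IsPrincipalLambert W →
    (∀ N : ℕ, ∀ t t' : ℝ, t ≤ t' → IterDefined W N t → IterDefined W N t') ∧
    ∀ T : ℝ, ∃ N : ℕ, ¬ IterDefined W N T

/-- **Step 6 — THE LIMIT IS A CONSTANT «FOR ALL t», §13 p.727 L397 + Fig. 23 p.730, §16 p.737
L477–479, §17 p.737 L481**:
«In the limit, the velocity approaches a constant for all t», «Infinite limit of n compositions of
solution approaches a constant», «Hence no finite time blowup can occur in the limit as n → ∞ for
the fixed point», «This is true for any n thus in the limit it is proposed that no finite-time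
blowup at infinity occurs and also no finite time singularites on [0,∞) can exist». Typed over the
real branch at model grain: at every time `t ≥ 2` (where `u₁` is real) all iterates are
real-defined and `u_N(t) → 1` (`= W`'s fixed point `0`, shifted by `+1`). The figures plot `Re` of
a complex branch with unspecified branch choices — that reading is NOT typed. Typist's flag: on the
reals jointly inconsistent with Step 5 (iii) (`not_step_6_of_step_5`); hedged «is proposed» in
print. [cite: Moschandreou2024b, §13 p.727 (L397) and Fig. 23 p.730 (L414); §16 p.737 (L477–479); §17 p.737 (L481)] -/
def Step_6 : Prop :=
  ∀ W : ℝ → ℝ, IsPrincipalLambert W →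
    ∀ t : ℝ, 2 ≤ t →
      (∀ N : ℕ, IterDefined W N t) ∧ Tendsto (fun N => modelIterate W N t) atTop (𝓝 1)

/-- **Step 6 (inference-schema reading)**, §16 p.737, L478–479: «This is true for any n thus in the limit
it is proposed that … no finite time singularites on [0,∞) can exist» — the passage from «the
n-th object has no singularity before its blow-up time `s_n`, and `s_n → ∞`» to «the limit object
has no singularity on [0,∞)», typed for real functions of `t` (the grain of Figures 17–23) with a
pointwise limit. Variant of Step 6 (same ordered index); the author marks the corresponding limit
statement as deferred to future work (§17 p.737 L482–483, see CARD §7). Typist's flag: known-false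
pattern (smooth `u_n → |t − 1|`). [cite: Moschandreou2024b, §16 p.737 (L478–479); §17 p.737 (L481–483)] -/
def Step_6lim : Prop :=
  ∀ (u : ℕ → ℝ → ℝ) (s : ℕ → ℝ) (v : ℝ → ℝ),
    Tendsto s atTop atTop →
    (∀ n, ContDiffOn ℝ 1 (u n) (Ico 0 (s n))) →
    (∀ t : ℝ, 0 ≤ t → Tendsto (fun n => u n t) atTop (𝓝 (v t))) →
    ContDiffOn ℝ 1 v (Ici 0)

/-- **Step 7 — §13 p.727, L398–399 (+ §2 p.699 L97)**: «proposition B of the millennium problem for the Navier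
Stokes equations involves proving that the forcing is zero which it will be when one differentiates
the constant velocity wrt to t and using Newton's second law. Of course the constant solution is
periodic for all x and t.» Typed: every constant velocity field is a Clay-sense global smooth
`ℤ³`-periodic solution of the UNFORCED system (with zero pressure). Typist's flag: true
(`step_7_holds`). [cite: Moschandreou2024b, §13 p.727 (L398–399); §2 p.699 (L97)] -/
def Step_7 : Prop :=
  ∀ ν : ℝ, 0 < ν → ∀ c : EuclideanSpace ℝ (Fin 3),
    ClayVariants.clayPeriodic.Solvable ν 0 (fun _ => c)

/-- **Step 8 — THE CLAY PASSAGE, §13 pp.727/730, L400–417 (with §1 p.697 L59–63)**: «One can …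
superimpose a more
general periodic solution about the constant ζ solution and fulfill the requirements for the
millennium problem. Note that in Equation (29) solutions are also of the form u_z = U₃ + Ψ₃(x,y),
u_y = U₂ + Ψ₂(x,z) and u_x = U₁ + Ψ(y,z). These functions can be taken to be periodic on ℝ × ℝ.
Superimposing is possible since x/√t is a constant in the limit as t → ∞.» Typed: for every
viscosity, every constant `c` and every Clay (B) datum `u₀` (smooth, divergence free, `ℤ³`-periodic)
the superimposed datum `c + u₀` has a Clay-sense global smooth periodic solution with `f ≡ 0`. This
is the claimed statement up to the constant (`step_8_iff_claimedTheorem`): the sentence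
presupposes the «more general periodic solution» it superimposes. Typist's flag: restatement of the
claim (ROUTE 5b pattern). [cite: Moschandreou2024b, §13 p.730 (L414–417); §1 p.697 (L59–63)] -/
def Step_8 : Prop :=
  ∀ ν : ℝ, 0 < ν → ∀ c : EuclideanSpace ℝ (Fin 3),
    ∀ u₀ : EuclideanSpace ℝ (Fin 3) → EuclideanSpace ℝ (Fin 3), ContDiff ℝ ∞ u₀ →
      NSWave0.IsDivFree u₀ → IsLatticePeriodic u₀ →
      ClayVariants.clayPeriodic.Solvable ν 0 (fun x => c + u₀ x)

/-! ## Logic: the circular bridge, the composition, the internal inconsistency of Steps 5/6 -/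

/-- **Step 8 is the claimed theorem** (up to adding a constant to the datum: `c = 0` one way; the
other way `c + u₀` is again a smooth divergence-free periodic datum). Kernel face of the ROUTE 5b
«circular» reading of §13 p.730 L414. [cite: Moschandreou2024b, §13 p.730 (L414–417)] -/
theorem step_8_iff_claimedTheorem : Step_8 ↔ ClaimedTheorem := by
  constructor
  · intro h ν hν u₀ hu₀ hdiv hper
    simpa using h ν hν 0 u₀ hu₀ hdiv hper
  · intro h ν hν c u₀ hu₀ hdiv hper
    refine h ν hν (fun x => c + u₀ x) (contDiff_const.add hu₀) ?_ ?_
    · intro x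
      have hfd : fderiv ℝ (fun y => c + u₀ y) x = fderiv ℝ u₀ x := fderiv_const_add c
      simp only [NSWave0.divergence, hfd]
      exact hdiv x
    · intro j x
      show c + u₀ (x + EuclideanSpace.single j 1) = c + u₀ x
      rw [hper j x]

/-- **COMPOSITION — proved, but the proof term consumes Step 8 alone** (Steps 1–7 build one constant
solution of a forced reduced model; Step 8 superimposes onto it the general periodic solution whose
existence is Clay (B)). `-- LOGIC: Steps 1–7 ↛ ClaimedTheorem without Step 8;`
`-- Step 8 ↔ ClaimedTheorem (step_8_iff_claimedTheorem).` [cite: Moschandreou2024b, §13 pp.727–730 (L394–417); §16 p.737 (L474–479)] -/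
theorem claim_of_steps :
    Step_1 → Step_2 → Step_3 → Step_4 → Step_5 → Step_6 → Step_7 → Step_8 → ClaimedTheorem :=
  fun _ _ _ _ _ _ _ h8 => step_8_iff_claimedTheorem.mp h8

/-- **On the real branch Steps 5 (iii) and 6 exclude each other**: Step 6 keeps every iterate
real-defined at `t = 2`, Step 5 (iii) makes some iterate leave the real domain at `T = 2` — given
ONE principal Lambert function (its existence, an inverse-function construction, is left to the
refuter/salvage seat and enters as a hypothesis). [cite: Moschandreou2024b, §13 p.727 (L395, L397); §16 p.737 (L475–477)] -/
theorem not_step_6_of_step_5 (hex : ∃ W : ℝ → ℝ, IsPrincipalLambert W) (h5 : Step_5) :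
    ¬ Step_6 := by
  intro h6
  obtain ⟨W, hW⟩ := hex
  obtain ⟨N, hN⟩ := (h5 W hW).2 2
  exact hN ((h6 W hW 2 le_rfl).1 N)

/-! ## The one routine step, discharged -/

/-- **Step 7 holds**: a constant velocity with zero pressure and zero force is a smooth
`ℤ³`-periodic solution of (1)–(3) on `ℝ³ × [0,∞)` in the Clay sense. [cite: Moschandreou2024b, §13 p.727 (L398–399)] -/
theorem step_7_holds : Step_7 := by
  intro ν _hν c
  refine ⟨fun _ _ => c, fun _ _ => 0, ?_, ?_, ?_, ?_⟩
  · exact contDiffOn_const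
  · exact contDiffOn_const
  · refine ⟨?_, ?_, rfl⟩
    · intro t _ht x
      have hΔ : (Δ fun _ : EuclideanSpace ℝ (Fin 3) => c) x = 0 := by
        rw [InnerProductSpace.laplacian_eq_iteratedFDeriv_stdOrthonormalBasis]
        simp [iteratedFDeriv_const_of_ne (𝕜 := ℝ) (E := EuclideanSpace ℝ (Fin 3)) two_ne_zero c]
      have hg : gradient (fun _ : EuclideanSpace ℝ (Fin 3) => (0 : ℝ)) x = 0 := by
        simp [gradient]
      simp [hΔ, hg]
    · intro t _ht x
      simp [NSWave0.divergence]
  · intro t _ht j x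
    rfl


/-! ## Steps 3 and 5 discharged: the real branch `W` of Lambert's function and the model iterates -/

/-- `w ↦ w·e^w` has derivative `(1 + w)·e^w`. [folklore] -/
private theorem hasDerivAt_mul_exp (w : ℝ) :
    HasDerivAt (fun w : ℝ => w * Real.exp w) ((1 + w) * Real.exp w) w := by
  have h := (hasDerivAt_id w).mul (Real.hasDerivAt_exp w)
  have e : (1 : ℝ) * Real.exp w + id w * Real.exp w = (1 + w) * Real.exp w := by
    simp only [id_eq]; ring
  rw [e] at h
  exact h

/-- `w ↦ w·e^w` is strictly increasing on `[−1, ∞)`. [folklore] -/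
private theorem strictMonoOn_mul_exp :
    StrictMonoOn (fun w : ℝ => w * Real.exp w) (Ici (-1)) := by
  refine strictMonoOn_of_deriv_pos (convex_Ici _)
    (fun w _ => (hasDerivAt_mul_exp w).continuousAt.continuousWithinAt) fun w hw => ?_
  rw [interior_Ici] at hw
  rw [(hasDerivAt_mul_exp w).deriv]
  exact mul_pos (by linarith [hw.out]) (Real.exp_pos w)

/-- At `w = −1` the value of `w·e^w` is `−e^{−1}`. [folklore] -/
private theorem neg_one_mul_exp : (-1 : ℝ) * Real.exp (-1) = -Real.exp (-1) := by ring

variable {W : ℝ → ℝ}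

/-- A principal Lambert function is monotone on its real domain `[−1/e, ∞)`. [folklore] -/
private theorem IsPrincipalLambert.mono (hW : IsPrincipalLambert W) {x y : ℝ}
    (hx : -Real.exp (-1) ≤ x) (hxy : x ≤ y) : W x ≤ W y := by
  have hy : -Real.exp (-1) ≤ y := hx.trans hxy
  rw [← strictMonoOn_mul_exp.le_iff_le (hW x hx).1 (hW y hy).1]
  simp only [(hW x hx).2, (hW y hy).2, hxy]

/-- The branch point: `W(−1/e) = −1`. [folklore] -/
private theorem IsPrincipalLambert.apply_branchPoint (hW : IsPrincipalLambert W) :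
    W (-Real.exp (-1)) = -1 := by
  have h := hW (-Real.exp (-1)) le_rfl
  refine strictMonoOn_mul_exp.injOn h.1 (self_mem_Ici) ?_
  simp only [h.2, neg_one_mul_exp]

/-- The range on the domain: every `w ≥ −1` is `W (w e^w)` with `w e^w ≥ −1/e`. [folklore] -/
private theorem IsPrincipalLambert.apply_mul_exp (hW : IsPrincipalLambert W) {w : ℝ} (hw : -1 ≤ w) :
    -Real.exp (-1) ≤ w * Real.exp w ∧ W (w * Real.exp w) = w := by
  have hdom : -Real.exp (-1) ≤ w * Real.exp w := by
    rw [← neg_one_mul_exp]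
    exact strictMonoOn_mul_exp.monotoneOn self_mem_Ici hw hw
  refine ⟨hdom, ?_⟩
  have h := hW _ hdom
  exact strictMonoOn_mul_exp.injOn h.1 hw h.2

/-- The image of the domain is `[−1, ∞)`. [folklore] -/
private theorem IsPrincipalLambert.Ici_subset_image (hW : IsPrincipalLambert W) :
    Ici (-1 : ℝ) ⊆ W '' Ici (-Real.exp (-1)) := fun w hw =>
  ⟨w * Real.exp w, (hW.apply_mul_exp hw).1, (hW.apply_mul_exp hw).2⟩

/-- On `[−1/e, 0)` the branch is negative: `W x < 0`. [folklore] -/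
private theorem IsPrincipalLambert.neg (hW : IsPrincipalLambert W) {x : ℝ}
    (hx : -Real.exp (-1) ≤ x) (hx0 : x < 0) : W x < 0 := by
  have h := (hW x hx).2
  have : W x * Real.exp (W x) < 0 := by rw [h]; exact hx0
  exact neg_of_mul_neg_left this (Real.exp_pos _).le

/-- Uniform decrease of the iteration `x ↦ W x` on `[−1/e, 0)`: if `W x ≤ w₀ < 0` then
`W x ≤ x − (−w₀)(1 − e^{w₀})`. [folklore] -/
private theorem IsPrincipalLambert.apply_le_sub (hW : IsPrincipalLambert W) {x w₀ : ℝ}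
    (hx : -Real.exp (-1) ≤ x) (hW0 : W x ≤ w₀) (hw₀ : w₀ < 0) :
    W x ≤ x - (-w₀) * (1 - Real.exp w₀) := by
  have h := (hW x hx).2
  have h1 : -w₀ ≤ -W x := by linarith
  have h2 : 1 - Real.exp w₀ ≤ 1 - Real.exp (W x) := by
    linarith [Real.exp_le_exp.2 hW0]
  have h3 : 0 ≤ 1 - Real.exp w₀ := by linarith [Real.exp_lt_one_iff.2 hw₀]
  have hprod : (-w₀) * (1 - Real.exp w₀) ≤ (-W x) * (1 - Real.exp (W x)) :=
    mul_le_mul h1 h2 h3 (by linarith)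
  have hexp : (-W x) * (1 - Real.exp (W x)) = -W x + x := by linear_combination h
  linarith [hprod, hexp]

/-- **Step 3 HOLDS (kernel)** — the branch point of the real principal Lambert function (§12 p.718
L299): on its domain `[−1/e, ∞)` the function `W` (characterised by `W ≥ −1`, `W e^W = id`) is
continuous — it is the inverse of the strictly increasing continuous `w ↦ w e^w` on `[−1,∞)`, with
image the interval `[−1,∞)` —, `W(−1/e) = −1`, and `W` is not differentiable at `−1/e` within the
domain: the chain rule applied to `W(x)·e^{W(x)} = x` at `x = −1/e` would give `0 · W'(−1/e) = 1`,
since `(w e^w)' = (1 + w)e^w` vanishes at `w = −1`. An in-file discharge of a step typed «true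
(classical)»; no statement of the file is modified. The same statement is independently
kernel-certified Summits-side by the salvage lane
(`Summit.NavierStokesRegularity.NavierStokesRegularity.Theorems.Moschandreou2024.step_3_holds` in
`SoloSalvageMoschandreou2024.lean`); it is re-proved here, where the fact is declared, because
Literature cannot import Summits. [cite: Moschandreou2024b, §12 p.718 (L299); §14 p.731 (L425)] -/
theorem step_3_holds : Step_3 := by
  intro W hW
  set a : ℝ := -Real.exp (-1) with ha
  have hWa : W a = -1 := hW.apply_branchPoint
  have hmono : MonotoneOn W (Ici a) := fun x hx y _ hxy => hW.mono hx hxy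
  refine ⟨?_, hWa, ?_⟩
  · -- continuity on the domain
    intro x hx
    rcases eq_or_lt_of_le (show a ≤ x from hx) with hax | hax
    · -- the endpoint: right-continuity
      subst hax
      have h := continuousWithinAt_right_of_monotoneOn_of_image_mem_nhdsWithin hmono
        self_mem_nhdsWithin (mem_of_superset self_mem_nhdsWithin (by rw [hWa]; exact hW.Ici_subset_image))
      exact h
    · -- an interior point: two-sided continuity
      have hWx : -1 < W x := by
        rcases eq_or_lt_of_le (hW x hx).1 with h | h
        · exfalso
          have := (hW x hx).2
          rw [← h, neg_one_mul_exp] at this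
          exact hax.ne this
        · exact h
      exact (continuousAt_of_monotoneOn_of_image_mem_nhds hmono (Ici_mem_nhds hax)
        (mem_of_superset (Ici_mem_nhds hWx) hW.Ici_subset_image)).continuousWithinAt
  · -- non-differentiability at the branch point
    intro hdiff
    have hWd : HasDerivWithinAt W (derivWithin W (Ici a) a) (Ici a) a := hdiff.hasDerivWithinAt
    have hg : HasDerivAt (fun w : ℝ => w * Real.exp w) ((1 + W a) * Real.exp (W a)) (W a) :=
      hasDerivAt_mul_exp (W a)
    have hcomp : HasDerivWithinAt (fun x => W x * Real.exp (W x))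
        ((1 + W a) * Real.exp (W a) * derivWithin W (Ici a) a) (Ici a) a :=
      hg.comp_hasDerivWithinAt a hWd
    rw [hWa, show (1 + (-1 : ℝ)) = 0 by norm_num, zero_mul, zero_mul] at hcomp
    have hid : HasDerivWithinAt (fun x : ℝ => x) (0 : ℝ) (Ici a) a :=
      hcomp.congr_of_mem (fun x hx => ((hW x hx).2).symm) self_mem_Ici
    have h01 := (uniqueDiffOn_Ici a a self_mem_Ici).eq_deriv _ hid (hasDerivWithinAt_id a (Ici a))
    exact zero_ne_one h01

/-- Monotonicity of the model arguments in `t`, propagated through the real domain: if the first `k`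
arguments at time `t` are real-defined and `t ≤ t'`, then the `k`-th argument at `t` is at most the one
at `t'`, and the first `k` arguments at `t'` are real-defined too. [folklore] -/
private theorem iterArg_mono_of_defined (hW : IsPrincipalLambert W) {t t' : ℝ} (htt' : t ≤ t') :
    ∀ k : ℕ, (∀ j, j < k → -Real.exp (-1) ≤ iterArg W j t) →
      iterArg W k t ≤ iterArg W k t' ∧ ∀ j, j < k → -Real.exp (-1) ≤ iterArg W j t' := by
  intro k
  induction k with
  | zero =>
    intro _
    refine ⟨?_, fun j hj => absurd hj (Nat.not_lt_zero j)⟩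
    rw [iterArg_zero, iterArg_zero, neg_le_neg_iff]
    exact Real.exp_le_exp.2 (by linarith)
  | succ k ih =>
    intro hdef
    obtain ⟨hle, hdef'⟩ := ih fun j hj => hdef j (Nat.lt_succ_of_lt hj)
    have hk : -Real.exp (-1) ≤ iterArg W k t := hdef k (Nat.lt_succ_self k)
    have hk' : -Real.exp (-1) ≤ iterArg W k t' := hk.trans hle
    refine ⟨?_, fun j hj => ?_⟩
    · rw [iterArg_succ, iterArg_succ]
      exact hW.mono hk hle
    · rcases Nat.lt_succ_iff_lt_or_eq.1 hj with hj | rfl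
      · exact hdef' j hj
      · exact hk'

/-- **Step 5 HOLDS (kernel)** on the model iterates `u_N(t) = W^{∘N}(−e^{1−t}) + 1` over the real
branch (§13 p.727 L395, Figs. 17–22): (ii) real-definedness is monotone in `t` (the arguments
increase with `t` and `W` is increasing on its domain); (iii) at any fixed time `T` some iterate has
left the real domain — on `[−1/e, 0)` one has `W(x) < x` with the uniform gap
`x − W(x) = (−W x)(1 − e^{W x}) ≥ (−w₀)(1 − e^{w₀})`, `w₀ = W(−e^{1−T}) < 0`, so the arguments decrease
at least linearly and cross `−1/e` after finitely many steps. An in-file discharge of a step typed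
«true on the model»; no statement of the file is modified. Together with `not_step_6_of_step_5` this
makes `Step_6` false over the reals as soon as a principal Lambert function is exhibited (done
Summits-side: `…Theorems.Moschandreou2024.exists_isPrincipalLambert`, `…not_step_6`). The same
statement is independently kernel-certified Summits-side by the salvage lane
(`Summit.NavierStokesRegularity.NavierStokesRegularity.Theorems.Moschandreou2024.step_5_holds` in
`SoloSalvageMoschandreou2024.lean`); it is re-proved here, where the fact is declared, because
Literature cannot import Summits. [cite: Moschandreou2024b, §13 p.727 (L395) with Figs. 17–22 pp.728–729 (L402–412); §16 p.737 (L474–475)] -/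
theorem step_5_holds : Step_5 := by
  intro W hW
  refine ⟨fun N t t' htt' hdef k hk => ?_, fun T => ?_⟩
  · exact ((iterArg_mono_of_defined hW htt' (k + 1)) fun j hj =>
      hdef j (lt_of_lt_of_le hj hk)).2 k (Nat.lt_succ_self k)
  · by_contra hall
    push Not at hall
    -- all arguments `a k = W^{∘k}(−e^{1−T})` are real-defined
    have hdom : ∀ k, -Real.exp (-1) ≤ iterArg W k T := fun k => hall (k + 1) k (Nat.lt_succ_self k)
    set a : ℕ → ℝ := fun k => iterArg W k T with ha
    have ha0 : a 0 < 0 := by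
      show iterArg W 0 T < 0
      rw [iterArg_zero]; exact neg_neg_of_pos (Real.exp_pos _)
    have hsucc : ∀ k, a (k + 1) = W (a k) := fun k => iterArg_succ W k T
    -- the arguments stay below `a 0 < 0`
    have hle0 : ∀ k, a k ≤ a 0 := by
      intro k
      induction k with
      | zero => exact le_rfl
      | succ k ih =>
        have hneg : a k < 0 := lt_of_le_of_lt ih ha0
        have hWlt : W (a k) < a k := by
          have h := hW.apply_le_sub (hdom k) le_rfl (hW.neg (hdom k) hneg)
          have hgap : 0 < (-W (a k)) * (1 - Real.exp (W (a k))) :=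
            mul_pos (by linarith [hW.neg (hdom k) hneg])
              (by linarith [Real.exp_lt_one_iff.2 (hW.neg (hdom k) hneg)])
          linarith
        rw [hsucc]
        exact hWlt.le.trans ih
    -- uniform gap
    set w₀ : ℝ := W (a 0) with hw₀
    have hw₀neg : w₀ < 0 := hW.neg (hdom 0) ha0
    set c : ℝ := (-w₀) * (1 - Real.exp w₀) with hc
    have hcpos : 0 < c := mul_pos (by linarith) (by linarith [Real.exp_lt_one_iff.2 hw₀neg])
    have hstep : ∀ k, a (k + 1) ≤ a k - c := fun k => by
      rw [hsucc]
      exact hW.apply_le_sub (hdom k) (hW.mono (hdom k) (hle0 k)) hw₀neg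
    have hlin : ∀ k : ℕ, a k ≤ a 0 - k * c := by
      intro k
      induction k with
      | zero => simp
      | succ k ih =>
        have := hstep k
        push_cast
        linarith
    -- contradiction for `k` large
    obtain ⟨k, hk⟩ := exists_nat_gt ((a 0 + Real.exp (-1)) / c)
    have h1 : a 0 + Real.exp (-1) < k * c := by rwa [div_lt_iff₀ hcpos] at hk
    have h2 := hlin k
    have h3 := hdom k
    change -Real.exp (-1) ≤ a k at h3
    linarith

end

end Literature.Claims.NS.Moschandreou2024
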